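import Literature.AlgebraicGeometry.HodgeTheory.ArapuraSurfaceFibredFourfolds
import Literature.AlgebraicGeometry.HodgeTheory.LefschetzOneOne
import Literature.AlgebraicGeometry.HodgeTheory.HardLefschetzNFold
import Literature.AlgebraicGeometry.HodgeTheory.HodgeModelExistence
import Literature.AlgebraicGeometry.HodgeTheory.SupportedHodgeClassDescent
import Literature.AlgebraicGeometry.HodgeTheory.HodgeFiltrationModels
import Literature.AlgebraicGeometry.HodgeTheory.SupportedClassesRationalProofs
import Literature.AlgebraicGeometry.HodgeTheory.VanishingCohomologyNontrivialProofs
import Literature.AlgebraicGeometry.HodgeTheory.GysinKernelProofs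
import Literature.AlgebraicGeometry.HodgeTheory.GysinFormalismCorrespondences
import Literature.AlgebraicGeometry.HodgeTheory.MotivatedClassesProofs
import Literature.AlgebraicGeometry.HodgeTheory.HodgeTypePullback
import Literature.AlgebraicGeometry.HodgeTheory.ComplexConjugation
import Literature.AlgebraicGeometry.Motives.ComplexPointsOrientation
import Literature.AlgebraicTopology.SingularHomology.GysinMapSupportProofs
import Literature.NumberTheory.Transcendental.ComplexFormsProofs
import Literature.NumberTheory.Transcendental.AnalytificationConnected
import HarnessLib

/-!
# Arapura 2022, Cor. 1.5 (fourfolds fibred over a surface by `p_g = 0` surfaces): the printed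
# reductions, proved (proof file; no new named fact)

Family `hodge`, layer `Literature/AlgebraicGeometry/HodgeTheory`. Proof file for the named fact
`Arapura2022_hodgeConjecture_pgZeroSurfaceFibration` of `ArapuraSurfaceFibredFourfolds.lean`
(D. Arapura, *Hodge cycles and the Leray filtration*, Pacific J. Math. 319 (2022) 233–258 =
arXiv:2103.05038, Corollary 1.5; held copy `paper:arxiv-2103.05038` read, pp. 3–5).

The fact is a genuine case of the Hodge conjecture. Its printed proof (Cor. 1.5 ← Cor. 1.4 ←
Thm. 1.2 + Thm. 1.1 + Lemma 1.2 of the source) has four layers: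

1. (Cor. 1.4, first sentence) "It is well known that the Hodge conjecture holds for smooth
   projective varieties of dimension at most three (by the Lefschetz `(1,1)` theorem, and the hard
   Lefschetz theorem)" — and, by the same two theorems, in every codimension `p ≠ 2` on a fourfold.
2. (Lemma 1.2 + Thm. 1.1 = Jannsen's theorem) "Let `U ⊂ X` be Zariski open, and `Z = X - U`. If
   `X` is projective and the Hodge conjecture holds for `U` and `Z`, then it holds for `X`", the
   conjecture for the singular threefold `Z = X - V` following from layer 1 for a desingularisation.
3. (Thm. 1.2) the Hodge conjecture for the smooth part `V = f⁻¹U → U` from the surjectivity of the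
   Leray-graded cycle maps `□^{p,i}` on the parallelogram `Q` (Deligne's degeneration of Leray, the
   author's mixed Hodge structures on `Gr_L`, hard Lefschetz on the fibres and for intersection
   cohomology [BBD], Peters–Saito surjectivity).
4. (Cor. 1.5 proper) for `dim Y = 2` the only point of `Q` with `p > 1` is `(2,2)`; with `p_g = 0`,
   Lefschetz `(1,1)` on a fibre and the relative Hilbert scheme give `R²f_*ℚ ≅ ℚ(-1)^N` after a
   finite base change, so `Hodge(H²(U, R²f_*ℚ)(2)) = ⊕ Hodge(H²(U, ℚ)(1)) ∪ [𝒵_i]` is spanned by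
   algebraic cycles (Lefschetz `(1,1)` on the base).

Layers 3–4 (Leray filtration, `Rⁱf_*ℚ`, mixed Hodge structures on open varieties, perverse hard
Lefschetz, relative Hilbert schemes) have no carrier in the tree or in Mathlib, and layer 1 rests
on the tree's UNPROVED named fact `lefschetzOneOne_rational` (whose `p = 1` instance on the total
space the fact literally contains: `lefschetzOneOne_of_pgZeroSurfaceFibration` below). This file
therefore does NOT discharge the fact. It PROVES layers 1 and 2 on the tree's real carriers, from
the tree's existing named facts, isolating the exact residual obligation — the output of layers
3–4, "the Hodge conjecture holds for `V`" for the classes of `X`, in the tree's spelling — as an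
explicit hypothesis (fact-decomposition discipline D-0026: nothing new is asserted, no `def`):

* `hodgeClasses_algebraic_fourfold_of_hodgeTwoTwo` — layer 1 for an arbitrary smooth projective
  fourfold: from `lefschetzOneOne_rational` (Voisin I, Thm. 11.30), `nonempty_hardLefschetzNFold 4 X`
  (Voisin I, Thm. 6.25, through the tree's proved `mem_algebraicClasses_of_lt_of_nonempty`) and the
  degree-`4` statement for `X`, rational `(p,p)`-classes are algebraic in every codimension `p`
  (pattern of `hodgeClasses_algebraic_cubicFourfold_of`).
* `mem_algebraicClasses_of_localization` — layer 2 for an arbitrary smooth projective `n`-fold and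
  an arbitrary proper Zariski-closed `Z ⊊ X`: granted the Hodge conjecture in dimension `< n` (as
  `HodgeConjectureFor`), a rational `(p,p)`-class that agrees OFF `Z` with an algebraic class is
  algebraic. Printed proof: the difference dies on `(X ∖ Z)(ℂ)`, i.e. lies in
  `N¹ H²ᵖ(X(ℂ); ℂ) = supportedClasses X (2p) 1` (`Z` has codimension `≥ 1`,
  `one_le_coheight_of_mem_of_isClosed`), algebraic classes lie in `Nᵖ ⊆ N¹`, and rational
  `(p,p)`-classes in `N¹` are algebraic by the tree's PROVED `supportedHodgeClassDescent_of`
  (Deligne, Hodge III 8.2.8 = `Deligne1974_ker_restrictCompl_eq_iSup_range_complexGysin`;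
  semisimplicity, Voisin 2025 Cor. 2.12 = `Voisin2025_hodgeClass_lift_complexGysin`; Hironaka =
  `Resolution.Hironaka1964_projective`; support of Gysin images = `gysinMap_restrictCompl_eq_zero`;
  Poincaré duality = an `OrientationFamily` with `HasPoincareDuality`) — which is Jannsen's
  argument [Arapura Thm. 1.1] run on the smooth compactification `X` instead of on the Borel–Moore
  homology of `Z`.
* `Arapura2022_hodgeConjecture_pgZeroSurfaceFibration_of_hodgeTwoTwo` and
  `Arapura2022_hodgeConjecture_pgZeroSurfaceFibration_of_localization` — the fact from those named
  facts plus, respectively, (a) its degree-`4` slice, (b) the residual of layers 3–4: there is a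
  proper Zariski-closed `T ⊊ Y` such that every rational `(2,2)`-class of `X` agrees off `f⁻¹T`
  with an algebraic class ("the Hodge conjecture holds for `V = f⁻¹(Y ∖ T)`", Thm. 1.2, for the
  classes restricted from `X`). So on the tree's current trust base Cor. 1.5 is EXACTLY: Lefschetz
  `(1,1)` + hard Lefschetz + the descent facts + (b).
* (v3: the former `Arapura2022_hodgeConjecture_fourfold_fibredBySurfaces_pg_zero_of_pgZeroSurfaceFibration`
  — the sibling rendering of the same corollary, `ArapuraFourfoldsFibredBySurfaces.lean` with
  "connected fibres" as Mathlib's `GeometricallyConnected f.left`, FOLLOWS from this file's fact — is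
  REMOVED as a duplicate: the identical statement landed independently as
  `Arapura2022_hodgeConjecture_fourfold_fibredBySurfaces_pg_zero.of_pgZeroSurfaceFibration` in
  `ArapuraFourfoldsFibredBySurfacesProofs.lean`, which is the one to use; one discharge serves both
  renderings.)
* `Arapura2022_hodgeConjecture_pgZeroSurfaceFibration.hodgeConjectureFor` — with a Hodge model
  (`nonempty_hodgeModel`), the fact gives `HodgeConjectureFor 4 X` in the summit's spelling;
  `lefschetzOneOne_of_pgZeroSurfaceFibration` — lower bound: the fact contains Lefschetz `(1,1)` for
  the total spaces `X` (its `p = 1` instance), which is why it cannot land before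
  `lefschetzOneOne_rational`.

## Appended (v2/v3): the fibre step of Cor. 1.5, vertical divisor classes, and two inputs of the localisation discharged

* `HodgeModel.hodgePQ_one_one_eq_top_of_finrank_eq_zero`, `isOfHodgeType_one_one_of_pg_zero`,
  `mem_algebraicClasses_one_of_pg_zero`, `algebraicClasses_one_eq_top_of_pg_zero` — THE FIBRE STEP
  of the printed proof of Cor. 1.5 ("Choose `y ∈ U - C`. Since `p_g(X_y) = 0`, by the Lefschetz
  `(1,1)` theorem, there exist irreducible divisors `Z_1, …, Z_N ⊂ X_y` which span `H²(X_y, ℚ)`"),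
  PROVED on the real carriers granted Lefschetz `(1,1)` (`hL`): on a smooth projective surface `F`
  with a Hodge model `A` with `h^{2,0}(A) = 0` (the fact's rendering of `p_g = 0`), `H^{2,0} = 0`
  (`Hᵏ(F^an; ℂ)` is finite-dimensional, `finite_complexBetti` through the analytification
  homeomorphism), hence `H^{0,2} = 0` by Hodge symmetry at the level of forms (the tree's PROVED
  `Motives.conj_hodgePQ_eq`, Voisin I Cor. 6.12, transported through the model's comparison
  `HodgeModel.hodgePQ_eq_bot_iff`), hence `H²(F^an; ℂ) = H^{1,1}` by the Hodge decomposition of the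
  model (`HodgeModel.hodgeFiltration_zero`); so EVERY class of `H²(F(ℂ); ℂ)` is of type `(1,1)`,
  every rational one is a divisor class (`hL`), and since rational classes span (the tree's PROVED
  `span_isRationalClass_eq_top_of_isSmoothProjective_holds`), `algebraicClasses F 1 = H²(F(ℂ); ℂ)`:
  the divisor classes span. `exists_complexPoint_pt_not_mem` is "choose `y ∈ U - C`" for the
  Zariski-closed `T` of the fact (Jacobson: a non-empty open subset of a `ℂ`-scheme locally of
  finite type has a complex point), and `exists_fiber_algebraicClasses_one_eq_top` assembles the
  step under the fact's hypotheses.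
* `map_mem_supportedClasses_one_of_surjective`, `map_mem_algebraicClasses_one_of_surjective`,
  `map_mem_algebraicClasses_one_of_hodgeOneOne` — THE VERTICAL DIVISOR CLASSES of the last line of
  the printed proof ("The Lefschetz `(1,1)` theorem now shows that
  `Hodge(H²(U, R²f_*ℚ)(2)) = ⊕ Hodge(H²(U, ℚ)(1)) ∪ [𝒵_i]` is spanned by algebraic cycles": the
  factor `Hodge(H²(U, ℚ)(1))` is the divisor classes of the base pulled back), in the compact form the
  tree can state: along a surjective morphism `f : X ⟶ Y` of smooth projective varieties, pull-back
  maps `N¹Hⁱ(Y(ℂ); ℂ)` into `N¹Hⁱ(X(ℂ); ℂ)` (a class dying off a proper closed `S ⊊ Y` pulls back to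
  one dying off the proper closed `f⁻¹S ⊊ X`, whose points have codimension `≥ 1` in the integral
  `X`), so divisor classes of `Y` — in particular, granted Lefschetz `(1,1)`, its rational
  `(1,1)`-classes — pull back to divisor classes of `X`. (Flatness is not needed in codimension `1`;
  the cup product with the `[𝒵_i]` would need the moving lemma, `cupProduct_mem_algebraicClasses_of_moving`,
  and is not asserted.)
* `exists_orientationFamily_hasPoincareDuality`, `mem_algebraicClasses_of_localization'`,
  `Arapura2022_hodgeConjecture_pgZeroSurfaceFibration_of_localization'` — two of the five inputs of
  the localisation step (layer 2) are now THEOREMS of the tree and are discharged: the support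
  property of Gysin maps over a field (`gysinMap_restrictCompl_eq_zero_of_field ℂ`,
  `SingularHomology/GysinMapSupportProofs`) and Poincaré duality for every orientation family
  (`OrientationFamily.hasPoincareDuality`, `GysinKernelProofs`, with the complex orientations
  `Motives.ComplexPoints.isOrientableOver`). The trust base of Cor. 1.5 on the tree's carriers is
  thereby: Lefschetz `(1,1)`, hard Lefschetz for fourfolds, the Hodge conjecture in dimension `≤ 3`
  with Hodge models, Deligne's Cor. 8.2.8, Voisin's Cor. 2.12, projective Hironaka, and the
  `V`-part (layers 3–4, no carrier in the tree).

## Appended (v4): "after a finite base change" — descent along morphisms of non-zero degree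

* `mem_algebraicClasses_of_map_mem_of_hasDegree`, `hodgeClasses_algebraic_of_hasDegree`,
  `HodgeConjectureFor.of_hasDegree`, `Arapura2022_hodgeConjecture_pgZeroSurfaceFibration_of_cover` —
  the printed proof of Cor. 1.5 trivialises `R²f_*ℚ` by the relative divisors `𝒵_i` only "after a
  finite base change" `Ỹ → Y`, i.e. it proves the conjecture on a smooth projective fourfold `X'`
  mapping to `X` with non-zero degree; the return to `X` is the standard degree argument, PROVED
  here on the tree's carriers: for `g : X' ⟶ X` of smooth projective varieties of the same
  dimension with `g(ℂ)_*[X'(ℂ)] = d • [X(ℂ)]`, `d ≠ 0` (`HasDegree`), one has `g_!(g^* c) = d • c`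
  (the tree's projection formula `gysinMap_map_of_hasDegree`, Poincaré duality `poincare_duality`),
  `g_!` preserves algebraic classes (`gysinMap_mem_algebraicClasses_of_isSmoothProjective`) and `g^*`
  preserves rational classes and Hodge types (`IsRationalClass.map`, `IsOfHodgeType.map_of_le`), so
  algebraicity of `g^* c` gives that of `c`, the Hodge conjecture for `X'` gives it for `X`, and
  Cor. 1.5 follows from its conclusion on any such cover `X'` of the total space.
* `Arapura2022_hodgeConjecture_pgZeroSurfaceFibration_of_localization_cover` — the whole printed
  skeleton on the tree's carriers: the named facts of layers 1–2 plus the output of Thm. 1.2 on the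
  smooth part of a finite base change (a cover `g : X' ⟶ X` of non-zero degree and a proper closed
  `Z' ⊊ X'` off which every rational `(2,2)`-class of `X'` is algebraic) imply the corollary:
  localisation on `X'`, Lefschetz `(1,1)` and hard Lefschetz in codimension `≠ 2`, descent along `g`.

## References

* [Arapura2022] D. Arapura, Hodge cycles and the Leray filtration, Pacific J. Math. 319 (2022)
  233–258, doi:10.2140/pjm.2022.319.233 = arXiv:2103.05038: §1, Thm. 1.1, Lemma 1.2, Thm. 1.2,
  Cor. 1.4, Cor. 1.5 (pp. 3–5 of the held text, read).
* [Jannsen1990MixedMotives] U. Jannsen, Mixed Motives and Algebraic K-Theory, LNM 1400 (1990) (Thm. 1.1 of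
  the source; cite-only).
* [Voisin2025] C. Voisin, J. Open Math. Probl. 1 (2025), Cor. 2.12, Thm. 4.4, Cor. 4.5.
* [DeligneHodgeIII1974] P. Deligne, Théorie de Hodge III, Publ. Math. IHÉS 44 (1974), Cor. 8.2.8.
* [VoisinHodgeI2002] C. Voisin, Hodge Theory and Complex Algebraic Geometry I, Thm. 6.25, §7.3.2,
  Thm. 11.30.
* [VoisinHodgeII2003] C. Voisin, Hodge Theory and Complex Algebraic Geometry II, §9.2.4
  Prop. 9.21 (ii).
* [Murre1977] J. P. Murre, Indag. Math. 80 (1977), Remark 1 (p. 230).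
* [Deligne2000] P. Deligne, The Hodge conjecture (Clay, 2000), §1.
* [HatcherAT2002] A. Hatcher, Algebraic Topology (CUP 2002), §3.1, §3.3 Thm. 3.30, App. A.
* [GortzWedhorn2020] U. Görtz, T. Wedhorn, Algebraic Geometry I, 2nd ed. (2020), Prop. 3.35.
* [FultonYoungTableaux1997] W. Fulton, Young Tableaux (CUP 1997), App. B.
* [GrothendieckTopology1969] A. Grothendieck, Hodge's general conjecture is false for trivial reasons, Topology 8 (1969), §1.
-/

noncomputable section

open AlgebraicGeometry
open Literature.AlgebraicTopology.SingularHomology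

namespace Literature.AlgebraicGeometry.HodgeTheory

section HodgeTheory

variable {n : ℕ} {X : Motives.SchemeOver ℂ}

/-! ### Layer 1: on a fourfold every codimension reduces to `p = 2` (Lefschetz `(1,1)` and hard Lefschetz) -/

/-- **Rational `(p,p)`-classes on a smooth projective complex fourfold are algebraic in every
codimension as soon as they are in codimension `2`**, granted Lefschetz `(1,1)` (`hL`, codimension
`1`) and hard Lefschetz (`hHL`, codimension `3` from codimension `1`, codimension `≥ 4` from
codimension `0`); codimension `0` is `algebraicClasses_zero`. Arapura, proof of Cor. 1.4: "It is
well known that the Hodge conjecture holds […] (by the Lefschetz `(1,1)` theorem, and the hard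
Lefschetz theorem)"; Murre 1977, Remark 1: "the `(1,1)` and `(3,3)`-conjecture are true for any
fourfold". [cite: Arapura2022, proof of Cor. 1.4] [cite: Murre1977, Remark 1 (p. 230)]
[cite: VoisinHodgeI2002, Thm. 6.25 and Thm. 11.30] -/
theorem hodgeClasses_algebraic_fourfold_of_hodgeTwoTwo (hL : lefschetzOneOne_rational)
    (hHL : nonempty_hardLefschetzNFold 4 X) (hX : Motives.IsSmoothProjective 4 X)
    (h2 : ∀ c : complexBetti X (2 * 2), IsRationalClass c → IsOfHodgeType 4 X (2 * 2) 2 2 c →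
      c ∈ algebraicClasses X 2)
    (p : ℕ) (c : complexBetti X (2 * p)) (hc : IsRationalClass c)
    (hpp : IsOfHodgeType 4 X (2 * p) p p c) : c ∈ algebraicClasses X p := by
  -- the codimensions `q ≤ 2` directly
  have low : ∀ q : ℕ, q ≤ 2 → ∀ c' : complexBetti X (2 * q), IsRationalClass c' →
      IsOfHodgeType 4 X (2 * q) q q c' → c' ∈ algebraicClasses X q := by
    intro q hq c' hc' hqq
    interval_cases q
    · rw [algebraicClasses_zero]
      exact Submodule.mem_top
    · exact hL hX c' hc' hqq
    · exact h2 c' hc' hqq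
  by_cases hp : p ≤ 2
  · exact low p hp c hc hpp
  · -- `p ≥ 3`: hard Lefschetz from codimension `4 - p ≤ 1`
    exact mem_algebraicClasses_of_lt_of_nonempty hHL hX (by omega) (low (4 - p) (by omega)) c hc hpp

/-! ### Layer 2: localisation (Lemma 1.2 with Jannsen's theorem, Thm. 1.1, on the smooth compactification) -/

/-- **Localisation.** Let `X` be smooth projective of dimension `n` over `ℂ`, assume the Hodge
conjecture for smooth projective varieties of dimension `< n`, and let `Z ⊊ X` be a proper
Zariski-closed subset. If a rational `(p,p)`-class `c` agrees on `(X ∖ Z)(ℂ)` with an algebraic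
class `b`, then `c` is algebraic. Arapura, Lemma 1.2: "If `X` is projective and the Hodge
conjecture holds for `U` and `Z`, then it holds for `X`" with Thm. 1.1 (Jannsen) for the singular
`Z`; here on the compactification: `c - b` dies off `Z`, so lies in `N¹ H²ᵖ(X(ℂ); ℂ)` (points of
`Z` have codimension `≥ 1`), `b ∈ Nᵖ ⊆ N¹`, hence `c ∈ N¹`, and rational `(p,p)`-classes supported
in codimension `≥ 1` are algebraic granted the conjecture in lower dimension
(`supportedHodgeClassDescent_of`: Deligne's Gysin description of `ker (H²ᵖ(X) → H²ᵖ(X ∖ Z))` via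
desingularised components, semisimplicity of polarisable Hodge structures, Hironaka).
[cite: Arapura2022, Lemma 1.2 and Thm. 1.1] [cite: Voisin2025, Cor. 2.12, Thm. 4.4 and Cor. 4.5]
[cite: DeligneHodgeIII1974, Cor. 8.2.8] -/
theorem mem_algebraicClasses_of_localization
    (hD : Deligne1974_ker_restrictCompl_eq_iSup_range_complexGysin)
    (hV : Voisin2025_hodgeClass_lift_complexGysin)
    (hH : Resolution.Hironaka1964_projective.{0}) (hS : gysinMap_restrictCompl_eq_zero.{0, 0} ℂ)
    (hμ : ∃ μ : OrientationFamily, μ.HasPoincareDuality)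
    (hX : Motives.IsSmoothProjective n X)
    (ih : ∀ ⦃m : ℕ⦄ ⦃Y : Motives.SchemeOver ℂ⦄, m < n → Motives.IsSmoothProjective m Y →
      HodgeConjectureFor m Y)
    {Z : Set X.left} (hZ : IsClosed Z) (hZne : Z ≠ Set.univ)
    {p : ℕ} {c : complexBetti X (2 * p)} (hc : IsRationalClass c)
    (hpp : IsOfHodgeType n X (2 * p) p p c)
    {b : complexBetti X (2 * p)} (hb : b ∈ algebraicClasses X p)
    (hcb : complexBetti.restrictCompl X Z (2 * p) (c - b) = 0) : c ∈ algebraicClasses X p := by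
  rcases Nat.eq_zero_or_pos p with rfl | hp
  · -- `p = 0`: `N⁰ H⁰ = H⁰`
    rw [algebraicClasses_zero]
    exact Submodule.mem_top
  -- `c - b ∈ N¹`: it dies off the closed `Z`, all of whose points have codimension `≥ 1`
  have h₁ : c - b ∈ supportedClasses X (2 * p) 1 :=
    mem_supportedClasses_of_restrictCompl_eq_zero hZ
      (fun z hz ↦ by exact_mod_cast one_le_coheight_of_mem_of_isClosed hX hZ hZne hz) hcb
  -- `b ∈ Nᵖ ⊆ N¹`
  have h₂ : b ∈ supportedClasses X (2 * p) 1 := supportedClasses_mono X (2 * p) hp hb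
  -- hence `c ∈ N¹`, a rational `(p,p)`-class supported in codimension `≥ 1`
  have h₃ : c ∈ supportedClasses X (2 * p) 1 := by
    have h := Submodule.add_mem _ h₁ h₂
    rwa [sub_add_cancel] at h
  exact supportedHodgeClassDescent_of hD hV hH hS hμ hX ih p c hc hpp h₃

/-- The lower-dimensional input of the localisation step for a FOURFOLD: the Hodge conjecture for
smooth projective varieties of dimension `≤ 3` (`hodgeClasses_algebraic_of_dim_le_three`, itself
Lefschetz `(1,1)` + hard Lefschetz, `hodgeClasses_algebraic_of_dim_le_three_of`) together with the
existence of Hodge models (`nonempty_hodgeModel`, the anti-vacuity conjunct of `HodgeConjectureFor`).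
[cite: Arapura2022, proof of Cor. 1.4] [cite: VoisinHodgeII2003, §10.2.3 proof of Prop. 10.26] -/
theorem hodgeConjectureFor_of_lt_four (h3 : hodgeClasses_algebraic_of_dim_le_three)
    (hA : ∀ (m : ℕ) (Y : Motives.SchemeOver ℂ), nonempty_hodgeModel m Y) :
    ∀ ⦃m : ℕ⦄ ⦃Y : Motives.SchemeOver ℂ⦄, m < 4 → Motives.IsSmoothProjective m Y →
      HodgeConjectureFor m Y :=
  fun m Y hm hY ↦ hodgeConjectureFor_of_dim_le_three h3 (hA m Y) (by omega) hY

/-! ### The fact from the named facts and the residual obligation -/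

/-- **Cor. 1.5 from its degree-`4` slice** (layer 1): granted Lefschetz `(1,1)` and hard Lefschetz
for fourfolds, Arapura's corollary is equivalent to its statement for rational `(2,2)`-classes
(the converse direction is the instance `p = 2`). [cite: Arapura2022, Cor. 1.5 and proof of Cor. 1.4] -/
theorem Arapura2022_hodgeConjecture_pgZeroSurfaceFibration_of_hodgeTwoTwo
    (hL : lefschetzOneOne_rational)
    (hHL : ∀ X : Motives.SchemeOver ℂ, nonempty_hardLefschetzNFold 4 X)
    (h2 : ∀ ⦃X Y : Motives.SchemeOver ℂ⦄ (f : X ⟶ Y),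
      Motives.IsSmoothProjective 4 X → Motives.IsSmoothProjective 2 Y →
      Function.Surjective f.left.base →
      (∀ y : Y.left, IsPreconnected (f.left.base ⁻¹' {y})) →
      (∃ T : Set Y.left, IsClosed T ∧ T ≠ Set.univ ∧
        ∀ s : Motives.AlgPoints Y ℂ, s.pt ∉ T →
          Motives.IsSmoothProjective 2 (Motives.fiberOver f s) ∧
          ∃ A : HodgeModel 2 (Motives.fiberOver f s), Module.finrank ℂ ↥(A.hodgePQ 2 2 0) = 0) →
      ∀ c : complexBetti X (2 * 2), IsRationalClass c → IsOfHodgeType 4 X (2 * 2) 2 2 c →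
        c ∈ algebraicClasses X 2) :
    Arapura2022_hodgeConjecture_pgZeroSurfaceFibration :=
  fun X _ f hX hY hf hconn hgen p c hc hpp ↦
    hodgeClasses_algebraic_fourfold_of_hodgeTwoTwo hL (hHL X) hX (h2 f hX hY hf hconn hgen) p c hc hpp

/-- **Cor. 1.5 from the named facts of layers 1–2 and the residual of layers 3–4.** Granted
Lefschetz `(1,1)` (`hL`), hard Lefschetz for fourfolds (`hHL`), the Hodge conjecture in dimension
`≤ 3` with Hodge models (`h3`, `hA`), and the descent facts behind Jannsen's theorem on the
compactification (`hD`, `hV`, `hH`, `hS`, `hμ`), Arapura's corollary follows from the output of his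
Thm. 1.2 for `V = f⁻¹U`, spelled on the tree's carriers (`hVpart`): there is a proper Zariski-closed
`T ⊊ Y` (`U = Y ∖ T`) such that every rational `(2,2)`-class of `X` agrees on `(X ∖ f⁻¹T)(ℂ)` with
an algebraic class. Proof as printed (Cor. 1.4): layer 1 reduces to `p = 2`; `f⁻¹T` is a proper
closed subset of `X` (`f` continuous and surjective); localisation (layer 2).
[cite: Arapura2022, Cor. 1.5, Cor. 1.4, Thm. 1.2, Lemma 1.2 and Thm. 1.1] -/
theorem Arapura2022_hodgeConjecture_pgZeroSurfaceFibration_of_localization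
    (hL : lefschetzOneOne_rational)
    (hHL : ∀ X : Motives.SchemeOver ℂ, nonempty_hardLefschetzNFold 4 X)
    (h3 : hodgeClasses_algebraic_of_dim_le_three)
    (hA : ∀ (m : ℕ) (Y : Motives.SchemeOver ℂ), nonempty_hodgeModel m Y)
    (hD : Deligne1974_ker_restrictCompl_eq_iSup_range_complexGysin)
    (hV : Voisin2025_hodgeClass_lift_complexGysin)
    (hH : Resolution.Hironaka1964_projective.{0}) (hS : gysinMap_restrictCompl_eq_zero.{0, 0} ℂ)
    (hμ : ∃ μ : OrientationFamily, μ.HasPoincareDuality)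
    (hVpart : ∀ ⦃X Y : Motives.SchemeOver ℂ⦄ (f : X ⟶ Y),
      Motives.IsSmoothProjective 4 X → Motives.IsSmoothProjective 2 Y →
      Function.Surjective f.left.base →
      (∀ y : Y.left, IsPreconnected (f.left.base ⁻¹' {y})) →
      (∃ T : Set Y.left, IsClosed T ∧ T ≠ Set.univ ∧
        ∀ s : Motives.AlgPoints Y ℂ, s.pt ∉ T →
          Motives.IsSmoothProjective 2 (Motives.fiberOver f s) ∧
          ∃ A : HodgeModel 2 (Motives.fiberOver f s), Module.finrank ℂ ↥(A.hodgePQ 2 2 0) = 0) →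
      ∃ T : Set Y.left, IsClosed T ∧ T ≠ Set.univ ∧
        ∀ c : complexBetti X (2 * 2), IsRationalClass c → IsOfHodgeType 4 X (2 * 2) 2 2 c →
          ∃ b ∈ algebraicClasses X 2,
            complexBetti.restrictCompl X (f.left.base ⁻¹' T) (2 * 2) (c - b) = 0) :
    Arapura2022_hodgeConjecture_pgZeroSurfaceFibration := by
  refine Arapura2022_hodgeConjecture_pgZeroSurfaceFibration_of_hodgeTwoTwo hL hHL ?_
  intro X Y f hX hY hf hconn hgen c hc hpp
  obtain ⟨T, hT, hTne, hcore⟩ := hVpart f hX hY hf hconn hgen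
  obtain ⟨b, hb, hcb⟩ := hcore c hc hpp
  -- `Z = f⁻¹T` is a proper closed subset of `X` (`f` continuous and surjective)
  have hZ : IsClosed (f.left.base ⁻¹' T) := hT.preimage f.left.continuous
  have hZne : f.left.base ⁻¹' T ≠ Set.univ := by
    intro h
    refine hTne (Set.eq_univ_of_forall fun y ↦ ?_)
    obtain ⟨x, rfl⟩ := hf y
    exact (h ▸ Set.mem_univ x : x ∈ f.left.base ⁻¹' T)
  exact mem_algebraicClasses_of_localization hD hV hH hS hμ hX (hodgeConjectureFor_of_lt_four h3 hA)
    hZ hZne hc hpp hb hcb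

/-- Upper bound for the residual: conversely the fact gives the `V`-part hypothesis of
`Arapura2022_hodgeConjecture_pgZeroSurfaceFibration_of_localization` (with `T = ∅`, `b = c`), so
the residual is a fragment of the corollary and nothing stronger than it is assumed there.
[cite: Arapura2022, Cor. 1.5 and Remark 1.3] -/
theorem Arapura2022_hodgeConjecture_pgZeroSurfaceFibration.localization_residual
    (h : Arapura2022_hodgeConjecture_pgZeroSurfaceFibration)
    ⦃X Y : Motives.SchemeOver ℂ⦄ (f : X ⟶ Y)
    (hX : Motives.IsSmoothProjective 4 X) (hY : Motives.IsSmoothProjective 2 Y)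
    (hf : Function.Surjective f.left.base)
    (hconn : ∀ y : Y.left, IsPreconnected (f.left.base ⁻¹' {y}))
    (hgen : ∃ T : Set Y.left, IsClosed T ∧ T ≠ Set.univ ∧
      ∀ s : Motives.AlgPoints Y ℂ, s.pt ∉ T →
        Motives.IsSmoothProjective 2 (Motives.fiberOver f s) ∧
        ∃ A : HodgeModel 2 (Motives.fiberOver f s), Module.finrank ℂ ↥(A.hodgePQ 2 2 0) = 0) :
    ∃ T : Set Y.left, IsClosed T ∧ T ≠ Set.univ ∧
      ∀ c : complexBetti X (2 * 2), IsRationalClass c → IsOfHodgeType 4 X (2 * 2) 2 2 c →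
        ∃ b ∈ algebraicClasses X 2,
          complexBetti.restrictCompl X (f.left.base ⁻¹' T) (2 * 2) (c - b) = 0 := by
  haveI := irreducibleSpace_of_isSmoothProjective' hY
  refine ⟨∅, isClosed_empty, fun h0 ↦ ?_, fun c hc hpp ↦ ⟨c, h f hX hY hf hconn hgen 2 c hc hpp, ?_⟩⟩
  · obtain ⟨y⟩ := (inferInstance : Nonempty Y.left)
    exact (h0.symm ▸ Set.mem_univ y : y ∈ (∅ : Set Y.left))
  · rw [sub_self, map_zero]

/-! ### Consequences and bounds -/

namespace Arapura2022_hodgeConjecture_pgZeroSurfaceFibration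

/-- With a Hodge model of the total space (the tree's `nonempty_hodgeModel`, the anti-vacuity
conjunct), Cor. 1.5 gives the full `HodgeConjectureFor 4 X` of the summit layer.
[cite: Arapura2022, Cor. 1.5] [cite: Deligne2000, §1] -/
theorem hodgeConjectureFor (h : Arapura2022_hodgeConjecture_pgZeroSurfaceFibration)
    {X Y : Motives.SchemeOver ℂ} (f : X ⟶ Y) (hX : Motives.IsSmoothProjective 4 X)
    (hY : Motives.IsSmoothProjective 2 Y) (hf : Function.Surjective f.left.base)
    (hconn : ∀ y : Y.left, IsPreconnected (f.left.base ⁻¹' {y}))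
    (hgen : ∃ T : Set Y.left, IsClosed T ∧ T ≠ Set.univ ∧
      ∀ s : Motives.AlgPoints Y ℂ, s.pt ∉ T →
        Motives.IsSmoothProjective 2 (Motives.fiberOver f s) ∧
        ∃ A : HodgeModel 2 (Motives.fiberOver f s), Module.finrank ℂ ↥(A.hodgePQ 2 2 0) = 0)
    (hA : nonempty_hodgeModel 4 X) : HodgeConjectureFor 4 X :=
  ⟨hA hX, h f hX hY hf hconn hgen⟩

end Arapura2022_hodgeConjecture_pgZeroSurfaceFibration

/-- **Lower bound: the fact contains Lefschetz `(1,1)` for its total spaces** (its instance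
`p = 1`): every rational `(1,1)`-class on a fourfold `X` fibred as in Cor. 1.5 is a divisor class.
This is the reason the fact cannot be discharged before the tree's named fact
`lefschetzOneOne_rational` (used as (F1) = `hL` above, exactly as in the printed proof).
[cite: Arapura2022, proof of Cor. 1.4 ("by the Lefschetz `(1,1)` theorem")] -/
theorem lefschetzOneOne_of_pgZeroSurfaceFibration
    (h : Arapura2022_hodgeConjecture_pgZeroSurfaceFibration)
    {X Y : Motives.SchemeOver ℂ} (f : X ⟶ Y) (hX : Motives.IsSmoothProjective 4 X)
    (hY : Motives.IsSmoothProjective 2 Y) (hf : Function.Surjective f.left.base)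
    (hconn : ∀ y : Y.left, IsPreconnected (f.left.base ⁻¹' {y}))
    (hgen : ∃ T : Set Y.left, IsClosed T ∧ T ≠ Set.univ ∧
      ∀ s : Motives.AlgPoints Y ℂ, s.pt ∉ T →
        Motives.IsSmoothProjective 2 (Motives.fiberOver f s) ∧
        ∃ A : HodgeModel 2 (Motives.fiberOver f s), Module.finrank ℂ ↥(A.hodgePQ 2 2 0) = 0)
    (c : complexBetti X (2 * 1)) (hc : IsRationalClass c) (h11 : IsOfHodgeType 4 X (2 * 1) 1 1 c) :
    c ∈ algebraicClasses X 1 :=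
  h f hX hY hf hconn hgen 1 c hc h11

/-! ### Appended (v2), I: the fibre step of Cor. 1.5 — on a `p_g = 0` surface the divisor classes span `H²` -/

/-- The cohomology `Hᵏ(X^an; ℂ)` of a Hodge model of a smooth projective `X` is finite-dimensional:
`Hᵏ(X(ℂ); ℂ)` is (`finite_complexBetti`, the compact manifold `X(ℂ)`) and the pull-back along the
analytification homeomorphism is onto (`HodgeModel.pullback_surjective`).
[cite: HatcherAT2002, App. A Cor. A.8–A.9 and §3.1 Cor. 3.3] -/
theorem HodgeModel.finite_singularCohomology_carrier (hX : Motives.IsSmoothProjective n X)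
    (A : HodgeModel n X) (k : ℕ) : Module.Finite ℂ (singularCohomology ℂ ℂ A.carrier k) := by
  haveI := finite_complexBetti hX k
  exact Module.Finite.of_surjective (A.pullback k).hom (A.pullback_surjective k)

/-- In a Hodge model of a smooth projective variety, a piece `H^{p,q}` of dimension `0` is zero
(the ambient `Hᵏ(X^an; ℂ)` being finite-dimensional, `finrank = 0` is not a junk value). This is
how the fact renders "`p_g = 0`": `dim H^{2,0} = 0`. [cite: VoisinHodgeI2002, §6.1.3] -/
theorem HodgeModel.hodgePQ_eq_bot_of_finrank_eq_zero (hX : Motives.IsSmoothProjective n X)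
    (A : HodgeModel n X) {k p q : ℕ} (h : Module.finrank ℂ ↥(A.hodgePQ k p q) = 0) :
    A.hodgePQ k p q = ⊥ := by
  haveI := A.finite_singularCohomology_carrier hX k
  exact Submodule.finrank_eq_zero.1 h

/-- **Hodge symmetry for the vanishing of a piece**: in any Hodge model, `H^{p,q} = 0` implies
`H^{q,p} = 0`. At the level of de Rham classes complex conjugation of forms maps the span of the
closed `(p,q)`-forms onto that of the closed `(q,p)`-forms (the tree's proved
`Motives.conj_hodgePQ_eq`, Voisin I Cor. 6.12: "we have `conj H^{p,q} = H^{q,p}`"), and `H^{p,q}`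
of the model vanishes iff the de Rham piece does (`HodgeModel.hodgePQ_eq_bot_iff`, the comparison
being an isomorphism) — no reality of the comparison is needed for this consequence.
[cite: VoisinHodgeI2002, Cor. 6.12] -/
theorem HodgeModel.hodgePQ_eq_bot_symm (A : HodgeModel n X) {k p q : ℕ}
    (h : A.hodgePQ k p q = ⊥) : A.hodgePQ k q p = ⊥ := by
  rw [A.hodgePQ_eq_bot_iff] at h ⊢
  rw [← Motives.conj_hodgePQ_eq Literature.NumberTheory.Transcendental.conj_mem_cclosedSmoothForms_holds
    Literature.NumberTheory.Transcendental.conj_mem_cexactSmoothForms_holds p q, h, Submodule.map_bot]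

/-- **On a Hodge model with `H^{2,0} = 0`, `H²(X^an; ℂ) = H^{1,1}`**: `H^{0,2} = 0` by Hodge
symmetry and `H² = H^{2,0} ⊕ H^{1,1} ⊕ H^{0,2}` by the Hodge decomposition of the model
(`HodgeModel.hodgeFiltration_zero`: the pieces span). Voisin I, Thm. 6.18 with Cor. 6.12.
[cite: VoisinHodgeI2002, Thm. 6.18 and Cor. 6.12] -/
theorem HodgeModel.hodgePQ_one_one_eq_top_of_finrank_eq_zero (hX : Motives.IsSmoothProjective n X)
    (A : HodgeModel n X) (hpg : Module.finrank ℂ ↥(A.hodgePQ 2 2 0) = 0) :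
    A.hodgePQ 2 1 1 = ⊤ := by
  have h20 : A.hodgePQ 2 2 0 = ⊥ := A.hodgePQ_eq_bot_of_finrank_eq_zero hX hpg
  have h02 : A.hodgePQ 2 0 2 = ⊥ := A.hodgePQ_eq_bot_symm h20
  rw [eq_top_iff, ← A.hodgeFiltration_zero 2]
  refine iSup_le fun p ↦ iSup_le fun q ↦ iSup_le fun hpq ↦ iSup_le fun _ ↦ ?_
  have hp : p ≤ 2 := by omega
  interval_cases p
  · obtain rfl : q = 2 := by omega
    exact h02 ▸ bot_le
  · obtain rfl : q = 1 := by omega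
    exact le_rfl
  · obtain rfl : q = 0 := by omega
    exact h20 ▸ bot_le

/-- **On a smooth projective surface with `p_g = 0` every class of `H²(X(ℂ); ℂ)` is of Hodge type
`(1,1)`** (in the fact's rendering: a Hodge model `A` with `dim H^{2,0}(A) = 0` witnesses the `∃`
of `IsOfHodgeType`, its `H^{1,1}` being everything). This is the content of "since `p_g(X_y) = 0`"
in the printed proof of Cor. 1.5. [cite: Arapura2022, proof of Cor. 1.5 (p. 5)]
[cite: VoisinHodgeI2002, Thm. 6.18 and Cor. 6.12] -/
theorem isOfHodgeType_one_one_of_pg_zero (hX : Motives.IsSmoothProjective 2 X) (A : HodgeModel 2 X)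
    (hpg : Module.finrank ℂ ↥(A.hodgePQ 2 2 0) = 0) (c : complexBetti X (2 * 1)) :
    IsOfHodgeType 2 X (2 * 1) 1 1 c := by
  refine ⟨A, ?_⟩
  change A.pullback 2 c ∈ A.hodgePQ 2 1 1
  rw [A.hodgePQ_one_one_eq_top_of_finrank_eq_zero hX hpg]
  exact Submodule.mem_top

/-- **The fibre step of Cor. 1.5, rational form**: on a smooth projective surface with `p_g = 0`,
granted Lefschetz `(1,1)` (`hL`), every rational class of `H²(X(ℂ); ℂ)` is a divisor class —
"Since `p_g(X_y) = 0`, by the Lefschetz `(1,1)` theorem, there exist irreducible divisors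
`Z_1, …, Z_N ⊂ X_y` which span `H²(X_y, ℚ)`." [cite: Arapura2022, proof of Cor. 1.5 (p. 5)]
[cite: VoisinHodgeI2002, Thm. 11.30] -/
theorem mem_algebraicClasses_one_of_pg_zero (hL : lefschetzOneOne_rational)
    (hX : Motives.IsSmoothProjective 2 X)
    (hpg : ∃ A : HodgeModel 2 X, Module.finrank ℂ ↥(A.hodgePQ 2 2 0) = 0)
    (c : complexBetti X (2 * 1)) (hc : IsRationalClass c) : c ∈ algebraicClasses X 1 := by
  obtain ⟨A, hA⟩ := hpg
  exact hL hX c hc (isOfHodgeType_one_one_of_pg_zero hX A hA c)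

/-- **The fibre step of Cor. 1.5, span form: on a smooth projective surface with `p_g = 0` the
divisor classes span `H²(X(ℂ); ℂ)`**, `algebraicClasses X 1 = N¹H² = H²(X(ℂ); ℂ)`, granted Lefschetz
`(1,1)`: the rational classes are divisor classes (`mem_algebraicClasses_one_of_pg_zero`) and span
`H²(X(ℂ); ℂ)` over `ℂ` (the tree's proved `span_isRationalClass_eq_top_of_isSmoothProjective_holds`,
`H²(X(ℂ); ℚ) ⊗ ℂ = H²(X(ℂ); ℂ)`). [cite: Arapura2022, proof of Cor. 1.5 (p. 5)]
[cite: VoisinHodgeI2002, Thm. 11.30 and §7.1.1] -/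
theorem algebraicClasses_one_eq_top_of_pg_zero (hL : lefschetzOneOne_rational)
    (hX : Motives.IsSmoothProjective 2 X)
    (hpg : ∃ A : HodgeModel 2 X, Module.finrank ℂ ↥(A.hodgePQ 2 2 0) = 0) :
    algebraicClasses X 1 = ⊤ := by
  rw [eq_top_iff, ← span_isRationalClass_eq_top_of_isSmoothProjective_holds 2 X hX (2 * 1),
    Submodule.span_le]
  exact fun c hc ↦ mem_algebraicClasses_one_of_pg_zero hL hX hpg c hc

/-- **"Choose `y ∈ U - C`"**: a proper Zariski-closed subset `T ⊊ |Y|` of a `ℂ`-scheme locally of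
finite type misses some complex point — its open complement is non-empty, so contains a closed
point (`Y` is Jacobson), i.e. the point of a complex point (Nullstellensatz,
`ComplexPoints.equivClosedPoints`). (The source removes a countable union `C` of proper closed
subsets and picks a very general `y`; the fact's hypothesis is already uniform off one closed `T`.)
[cite: Arapura2022, proof of Cor. 1.5 (p. 5)] [cite: GortzWedhorn2020, Prop. 3.35] -/
theorem exists_complexPoint_pt_not_mem {Y : Motives.SchemeOver ℂ} [LocallyOfFiniteType Y.hom]
    {T : Set Y.left} (hT : IsClosed T) (hTne : T ≠ Set.univ) :
    ∃ P : Motives.ComplexPoints Y, P.pt ∉ T := by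
  haveI : JacobsonSpace ↥Y.left := Motives.ComplexPoints.jacobsonSpace_left
  obtain ⟨x, hxT, hxc⟩ := nonempty_inter_closedPoints (X := ↥Y.left) (Set.nonempty_compl.mpr hTne)
    hT.isOpen_compl.isLocallyClosed
  exact ⟨(Motives.ComplexPoints.equivClosedPoints Y).symm ⟨x, hxc⟩,
    by rwa [Motives.ComplexPoints.pt_equivClosedPoints_symm_apply]⟩

/-- **The fibre step under the hypotheses of Cor. 1.5.** Granted Lefschetz `(1,1)`, for `f : X ⟶ Y`
onto a smooth projective surface whose fibres off a proper Zariski-closed `T` are smooth projective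
surfaces with `p_g = 0`: there IS a complex point `y` off `T`, and for EVERY such `y` the divisor
classes span `H²(X_y(ℂ); ℂ)` (`algebraicClasses X_y 1 = ⊤`) — the classes `[Z_1], …, [Z_N]` of the
printed proof, before they are spread over `U` by the relative Hilbert scheme (which the tree does
not have). [cite: Arapura2022, proof of Cor. 1.5 (p. 5)] [cite: VoisinHodgeI2002, Thm. 11.30] -/
theorem exists_fiber_algebraicClasses_one_eq_top (hL : lefschetzOneOne_rational)
    {X Y : Motives.SchemeOver ℂ} (f : X ⟶ Y) (hY : Motives.IsSmoothProjective 2 Y)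
    (hgen : ∃ T : Set Y.left, IsClosed T ∧ T ≠ Set.univ ∧
      ∀ s : Motives.AlgPoints Y ℂ, s.pt ∉ T →
        Motives.IsSmoothProjective 2 (Motives.fiberOver f s) ∧
        ∃ A : HodgeModel 2 (Motives.fiberOver f s), Module.finrank ℂ ↥(A.hodgePQ 2 2 0) = 0) :
    ∃ T : Set Y.left, IsClosed T ∧ T ≠ Set.univ ∧ (∃ s : Motives.AlgPoints Y ℂ, s.pt ∉ T) ∧
      ∀ s : Motives.AlgPoints Y ℂ, s.pt ∉ T →
        Motives.IsSmoothProjective 2 (Motives.fiberOver f s) ∧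
          algebraicClasses (Motives.fiberOver f s) 1 = ⊤ := by
  obtain ⟨T, hT, hTne, hgen⟩ := hgen
  haveI := hY.smoothOfRelativeDimension
  haveI : Smooth Y.hom := SmoothOfRelativeDimension.smooth 2 Y.hom
  refine ⟨T, hT, hTne, exists_complexPoint_pt_not_mem hT hTne, fun s hs ↦ ?_⟩
  obtain ⟨hF, hpg⟩ := hgen s hs
  exact ⟨hF, algebraicClasses_one_eq_top_of_pg_zero hL hF hpg⟩

/-! ### Appended (v3), III: vertical divisor classes — pull-back of `N¹` along the fibration -/

/-- **Pull-back along a surjective morphism of smooth projective varieties preserves `N¹`**: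
for `f : X ⟶ Y` surjective on points, `X`, `Y` smooth projective (integral), and a class
`d ∈ N¹Hⁱ(Y(ℂ); ℂ)` — dying off ONE Zariski-closed `S` of codimension `≥ 1`
(`exists_isClosed_of_mem_supportedClasses`), so `S ≠ Y` (the generic point of `Y` has codimension
`0`) — the pull-back `f^*d` dies off `f⁻¹S` (`complexBetti.restrictCompl_map_eq_zero`), a closed
subset which is proper (`f` is onto and `S ≠ Y`) hence of codimension `≥ 1` in the integral `X`
(`one_le_coheight_of_mem_of_isClosed`). No flatness is needed in codimension `1` (contrast
`map_mem_supportedClasses_of_flat`). [cite: GrothendieckTopology1969, §1]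
[cite: Arapura2022, proof of Cor. 1.5 (p. 5)] -/
theorem map_mem_supportedClasses_one_of_surjective {m : ℕ} {X Y : Motives.SchemeOver ℂ}
    (hX : Motives.IsSmoothProjective n X) (hY : Motives.IsSmoothProjective m Y) (f : X ⟶ Y)
    (hf : Function.Surjective f.left.base) {i : ℕ} {d : complexBetti Y i}
    (hd : d ∈ supportedClasses Y i 1) : complexBetti.map f i d ∈ supportedClasses X i 1 := by
  obtain ⟨S, hS, hcoh, hdS⟩ := exists_isClosed_of_mem_supportedClasses hd
  haveI := irreducibleSpace_of_isSmoothProjective' hY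
  -- `S ≠ Y`: the generic point of `Y` has codimension `0`
  have hSne : S ≠ Set.univ := by
    intro hS'
    have h := hcoh (genericPoint Y.left) (hS'.symm ▸ Set.mem_univ _)
    have hmax : IsMax (genericPoint Y.left) := fun z _ ↦
      Scheme.le_iff_specializes.2 ((genericPoint_spec Y.left).specializes (Set.mem_univ z))
    rw [Order.coheight_eq_zero.2 hmax] at h
    exact absurd h (by simp)
  -- `f⁻¹S` is a proper closed subset of `X`
  have hZ : IsClosed (f.left.base ⁻¹' S) := hS.preimage f.left.continuous
  have hZne : f.left.base ⁻¹' S ≠ Set.univ := by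
    intro h
    refine hSne (Set.eq_univ_of_forall fun y ↦ ?_)
    obtain ⟨x, rfl⟩ := hf y
    exact (h ▸ Set.mem_univ x : x ∈ f.left.base ⁻¹' S)
  exact mem_supportedClasses_of_restrictCompl_eq_zero hZ
    (fun z hz ↦ by exact_mod_cast one_le_coheight_of_mem_of_isClosed hX hZ hZne hz)
    (complexBetti.restrictCompl_map_eq_zero f hdS)

/-- **Divisor classes of the base pull back to divisor classes of the total space**
(`algebraicClasses _ 1 = N¹H²`), along a surjective morphism of smooth projective varieties: the
compact form of the vertical classes `f^*Hodge(H²(U, ℚ)(1))` of the printed proof of Cor. 1.5.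
[cite: Arapura2022, proof of Cor. 1.5 (p. 5)] [cite: GrothendieckTopology1969, §1] -/
theorem map_mem_algebraicClasses_one_of_surjective {m : ℕ} {X Y : Motives.SchemeOver ℂ}
    (hX : Motives.IsSmoothProjective n X) (hY : Motives.IsSmoothProjective m Y) (f : X ⟶ Y)
    (hf : Function.Surjective f.left.base) {d : complexBetti Y (2 * 1)}
    (hd : d ∈ algebraicClasses Y 1) : complexBetti.map f (2 * 1) d ∈ algebraicClasses X 1 :=
  map_mem_supportedClasses_one_of_surjective hX hY f hf hd

/-- **"The Lefschetz `(1,1)` theorem now shows …" on the base**: granted Lefschetz `(1,1)` (`hL`),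
the rational `(1,1)`-classes of the smooth projective base `Y` pull back along the surjective
`f : X ⟶ Y` to divisor classes of `X` (Lefschetz `(1,1)` on `Y`, then
`map_mem_algebraicClasses_one_of_surjective`). [cite: Arapura2022, proof of Cor. 1.5 (p. 5)]
[cite: VoisinHodgeI2002, Thm. 11.30] -/
theorem map_mem_algebraicClasses_one_of_hodgeOneOne (hL : lefschetzOneOne_rational) {m : ℕ}
    {X Y : Motives.SchemeOver ℂ}
    (hX : Motives.IsSmoothProjective n X) (hY : Motives.IsSmoothProjective m Y) (f : X ⟶ Y)
    (hf : Function.Surjective f.left.base) {d : complexBetti Y (2 * 1)} (hd : IsRationalClass d)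
    (h11 : IsOfHodgeType m Y (2 * 1) 1 1 d) : complexBetti.map f (2 * 1) d ∈ algebraicClasses X 1 :=
  map_mem_algebraicClasses_one_of_surjective hX hY f hf (hL hY d hd h11)


/-! ### Appended (v2), II: two inputs of the localisation step are theorems — discharged -/

/-- **The complex orientation family has Poincaré duality** — indeed every orientation family does
(the tree's theorem `OrientationFamily.hasPoincareDuality`, Hatcher Thm. 3.30 for the closed
manifolds `X(ℂ)`), and one exists (`Motives.ComplexPoints.isOrientableOver`: `X(ℂ)` is
`ℂ`-orientable for `X` smooth projective). Discharges the hypothesis `hμ` of the localisation.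
[cite: HatcherAT2002, §3.3 Thm. 3.30] [cite: FultonYoungTableaux1997, Appendix B §B.1 (4)] -/
theorem exists_orientationFamily_hasPoincareDuality :
    ∃ μ : OrientationFamily, μ.HasPoincareDuality :=
  ⟨fun _ _ h ↦ Classical.choice (Motives.ComplexPoints.isOrientableOver ℂ h),
    OrientationFamily.hasPoincareDuality _⟩

/-- **Localisation (layer 2), with the support property of Gysin maps and Poincaré duality
discharged**: `mem_algebraicClasses_of_localization` fed with the tree's theorems
`gysinMap_restrictCompl_eq_zero_of_field ℂ` and `exists_orientationFamily_hasPoincareDuality`. What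
remains assumed: Deligne's Cor. 8.2.8 (`hD`), Voisin's Cor. 2.12 (`hV`), projective Hironaka (`hH`),
and the Hodge conjecture in dimension `< n` (`ih`).
[cite: Arapura2022, Lemma 1.2 and Thm. 1.1] [cite: Voisin2025, Cor. 2.12, Thm. 4.4 and Cor. 4.5]
[cite: DeligneHodgeIII1974, Cor. 8.2.8] -/
theorem mem_algebraicClasses_of_localization'
    (hD : Deligne1974_ker_restrictCompl_eq_iSup_range_complexGysin)
    (hV : Voisin2025_hodgeClass_lift_complexGysin) (hH : Resolution.Hironaka1964_projective.{0})
    (hX : Motives.IsSmoothProjective n X)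
    (ih : ∀ ⦃m : ℕ⦄ ⦃Y : Motives.SchemeOver ℂ⦄, m < n → Motives.IsSmoothProjective m Y →
      HodgeConjectureFor m Y)
    {Z : Set X.left} (hZ : IsClosed Z) (hZne : Z ≠ Set.univ)
    {p : ℕ} {c : complexBetti X (2 * p)} (hc : IsRationalClass c)
    (hpp : IsOfHodgeType n X (2 * p) p p c)
    {b : complexBetti X (2 * p)} (hb : b ∈ algebraicClasses X p)
    (hcb : complexBetti.restrictCompl X Z (2 * p) (c - b) = 0) : c ∈ algebraicClasses X p :=
  mem_algebraicClasses_of_localization hD hV hH (gysinMap_restrictCompl_eq_zero_of_field ℂ)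
    exists_orientationFamily_hasPoincareDuality hX ih hZ hZne hc hpp hb hcb

/-- **Cor. 1.5 from the named facts and the `V`-part, with the support property of Gysin maps and
Poincaré duality discharged** (`Arapura2022_hodgeConjecture_pgZeroSurfaceFibration_of_localization`
with `hS := gysinMap_restrictCompl_eq_zero_of_field ℂ` and
`hμ := exists_orientationFamily_hasPoincareDuality`). On the tree's current theorems Cor. 1.5 is
thus EXACTLY: Lefschetz `(1,1)` (`hL`) + hard Lefschetz for fourfolds (`hHL`) + the Hodge conjecture
in dimension `≤ 3` with Hodge models (`h3`, `hA`) + Deligne's Cor. 8.2.8 (`hD`) + Voisin's Cor. 2.12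
(`hV`) + projective Hironaka (`hH`) + the output of Thm. 1.2 for `V = f⁻¹U` (`hVpart`).
[cite: Arapura2022, Cor. 1.5, Cor. 1.4, Thm. 1.2, Lemma 1.2 and Thm. 1.1] -/
theorem Arapura2022_hodgeConjecture_pgZeroSurfaceFibration_of_localization'
    (hL : lefschetzOneOne_rational)
    (hHL : ∀ X : Motives.SchemeOver ℂ, nonempty_hardLefschetzNFold 4 X)
    (h3 : hodgeClasses_algebraic_of_dim_le_three)
    (hA : ∀ (m : ℕ) (Y : Motives.SchemeOver ℂ), nonempty_hodgeModel m Y)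
    (hD : Deligne1974_ker_restrictCompl_eq_iSup_range_complexGysin)
    (hV : Voisin2025_hodgeClass_lift_complexGysin) (hH : Resolution.Hironaka1964_projective.{0})
    (hVpart : ∀ ⦃X Y : Motives.SchemeOver ℂ⦄ (f : X ⟶ Y),
      Motives.IsSmoothProjective 4 X → Motives.IsSmoothProjective 2 Y →
      Function.Surjective f.left.base →
      (∀ y : Y.left, IsPreconnected (f.left.base ⁻¹' {y})) →
      (∃ T : Set Y.left, IsClosed T ∧ T ≠ Set.univ ∧
        ∀ s : Motives.AlgPoints Y ℂ, s.pt ∉ T →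
          Motives.IsSmoothProjective 2 (Motives.fiberOver f s) ∧
          ∃ A : HodgeModel 2 (Motives.fiberOver f s), Module.finrank ℂ ↥(A.hodgePQ 2 2 0) = 0) →
      ∃ T : Set Y.left, IsClosed T ∧ T ≠ Set.univ ∧
        ∀ c : complexBetti X (2 * 2), IsRationalClass c → IsOfHodgeType 4 X (2 * 2) 2 2 c →
          ∃ b ∈ algebraicClasses X 2,
            complexBetti.restrictCompl X (f.left.base ⁻¹' T) (2 * 2) (c - b) = 0) :
    Arapura2022_hodgeConjecture_pgZeroSurfaceFibration :=
  Arapura2022_hodgeConjecture_pgZeroSurfaceFibration_of_localization hL hHL h3 hA hD hV hH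
    (gysinMap_restrictCompl_eq_zero_of_field ℂ) exists_orientationFamily_hasPoincareDuality hVpart


/-! ### Appended (v4), IV: "after a finite base change" — algebraicity and the Hodge conjecture
descend along morphisms of non-zero degree -/

section Degree

variable {X' : Motives.SchemeOver ℂ}

/-- **Algebraicity descends along a morphism of non-zero degree.** Let `g : X' ⟶ X` be a
`ℂ`-morphism of smooth projective varieties of the same dimension `n` whose continuous map
`g(ℂ) : X'(ℂ) → X(ℂ)` has degree `d ≠ 0` with respect to orientations `μ` of `X'(ℂ)` and `ν` of
`X(ℂ)` (`g(ℂ)_*[X'(ℂ)] = d • [X(ℂ)]`, `HasDegree`; e.g. `g` generically finite and dominant of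
degree `d`). If the pull-back `g^* c` of a class `c ∈ H²ᵖ(X(ℂ); ℂ)` is algebraic on `X'`, then `c`
is algebraic on `X`: `g_!(g^* c) = d • c` (projection formula, Fulton App. B (6)–(7), the tree's
`gysinMap_map_of_hasDegree`; Poincaré duality for `X(ℂ)` is the tree's theorem `poincare_duality`),
and the Gysin homomorphism maps `Nᵖ H²ᵖ(X'(ℂ); ℂ)` into `Nᵖ H²ᵖ(X(ℂ); ℂ)`
(`gysinMap_mem_algebraicClasses_of_isSmoothProjective`, Voisin II Prop. 9.21 (ii)), so
`c = d⁻¹ • g_!(g^* c)` is algebraic (degrees `2p > 2n` carry no classes). This is why the "finite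
base change" of the printed proof of Cor. 1.5 ("It follows that, after a finite base change,
`[𝒵_1], …, [𝒵_N]` gives a basis of `R²f_*ℚ`") is harmless for the conclusion on `X`.
[cite: Arapura2022, proof of Cor. 1.5 (p. 5)] [cite: FultonYoungTableaux1997, Appendix B §B.1 (5)–(7)]
[cite: VoisinHodgeII2003, §9.2.4 Prop. 9.21 (ii)] [cite: HatcherAT2002, §3.3 Thm. 3.30] -/
theorem mem_algebraicClasses_of_map_mem_of_hasDegree (hX' : Motives.IsSmoothProjective n X')
    (hX : Motives.IsSmoothProjective n X) (g : X' ⟶ X)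
    (μ : HomologicalOrientation ℂ (Motives.ComplexPoints X') (2 * n))
    (ν : HomologicalOrientation ℂ (Motives.ComplexPoints X) (2 * n)) {d : ℤ} (hd : d ≠ 0)
    (hg : HasDegree μ ν (Motives.AlgPoints.mapContinuous (L := ℂ) g) d)
    {p : ℕ} {c : complexBetti X (2 * p)} (hc : complexBetti.map g (2 * p) c ∈ algebraicClasses X' p) :
    c ∈ algebraicClasses X p := by
  by_cases hp : p ≤ n
  · -- Poincaré duality for `X(ℂ)` (Hatcher Thm. 3.30, proved in the tree)
    have hν : ν.HasPoincareDuality := fun _ _ h ↦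
      Motives.ComplexPoints.bijective_poincareDualityMap_of (fun ν' _ _ h' ↦ poincare_duality ν' h')
        hX ν h
    have h : 2 * p + (2 * n - 2 * p) = 2 * n := by omega
    have hc' : singularCohomology.map ℂ ℂ (Motives.AlgPoints.mapContinuous (L := ℂ) g) (2 * p) c ∈
        algebraicClasses X' p := hc
    -- `g_!(g^* c)` is algebraic …
    have halg : gysinMap μ ν (Motives.AlgPoints.mapContinuous (L := ℂ) g) h h
        (singularCohomology.map ℂ ℂ (Motives.AlgPoints.mapContinuous (L := ℂ) g) (2 * p) c) ∈
          algebraicClasses X p :=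
      gysinMap_mem_algebraicClasses_of_isSmoothProjective hX' hX μ ν hν g h h rfl hc'
    -- … and equals `d • c`
    rw [gysinMap_map_of_hasDegree hν hg h c, ← Int.cast_smul_eq_zsmul ℂ d c] at halg
    exact ((algebraicClasses X p).smul_mem_iff (Int.cast_ne_zero.2 hd)).1 halg
  · -- `2p > 2n`: `H²ᵖ(X(ℂ); ℂ) = 0`
    haveI := subsingleton_complexBetti hX (k := 2 * p) (by omega)
    rw [Subsingleton.elim c 0]
    exact Submodule.zero_mem _

/-- **The Hodge conjecture descends along morphisms of non-zero degree** ("after a finite base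
change"): for `X'`, `X` smooth projective of dimension `n`, `X'` with a Hodge model `B`, and
`g : X' ⟶ X` of degree `d ≠ 0`, if the rational `(p,p)`-classes of `X'` are algebraic then so are
those of `X` — `g^*` preserves rational classes (`IsRationalClass.map`) and Hodge types
(`IsOfHodgeType.map_of_le`, Voisin I §7.3.2: "`φ^*` is a morphism of Hodge structures"), and
algebraicity descends (`mem_algebraicClasses_of_map_mem_of_hasDegree`).
[cite: Arapura2022, proof of Cor. 1.5 (p. 5)] [cite: VoisinHodgeI2002, §7.3.2]
[cite: FultonYoungTableaux1997, Appendix B §B.1 (5)–(7)] -/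
theorem hodgeClasses_algebraic_of_hasDegree (hX' : Motives.IsSmoothProjective n X')
    (hX : Motives.IsSmoothProjective n X) (g : X' ⟶ X) (B : HodgeModel n X')
    (μ : HomologicalOrientation ℂ (Motives.ComplexPoints X') (2 * n))
    (ν : HomologicalOrientation ℂ (Motives.ComplexPoints X) (2 * n)) {d : ℤ} (hd : d ≠ 0)
    (hg : HasDegree μ ν (Motives.AlgPoints.mapContinuous (L := ℂ) g) d)
    (h' : ∀ (p : ℕ) (c' : complexBetti X' (2 * p)), IsRationalClass c' →
      IsOfHodgeType n X' (2 * p) p p c' → c' ∈ algebraicClasses X' p)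
    (p : ℕ) (c : complexBetti X (2 * p)) (hc : IsRationalClass c)
    (hpp : IsOfHodgeType n X (2 * p) p p c) : c ∈ algebraicClasses X p :=
  mem_algebraicClasses_of_map_mem_of_hasDegree hX' hX g μ ν hd hg
    (h' p _ (hc.map (Motives.AlgPoints.mapContinuous (L := ℂ) g)) (hpp.map_of_le hX' hX B g le_rfl))

/-- In the summit's spelling: `HodgeConjectureFor n X'` (which supplies the Hodge model of `X'`)
and a Hodge model of `X` give `HodgeConjectureFor n X` along any `g : X' ⟶ X` of non-zero degree.
[cite: Arapura2022, proof of Cor. 1.5 (p. 5)] [cite: VoisinHodgeI2002, §7.3.2] [cite: Deligne2000, §1] -/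
theorem HodgeConjectureFor.of_hasDegree (h' : HodgeConjectureFor n X')
    (hX' : Motives.IsSmoothProjective n X') (hX : Motives.IsSmoothProjective n X) (g : X' ⟶ X)
    (μ : HomologicalOrientation ℂ (Motives.ComplexPoints X') (2 * n))
    (ν : HomologicalOrientation ℂ (Motives.ComplexPoints X) (2 * n)) {d : ℤ} (hd : d ≠ 0)
    (hg : HasDegree μ ν (Motives.AlgPoints.mapContinuous (L := ℂ) g) d)
    (hA : Nonempty (HodgeModel n X)) : HodgeConjectureFor n X :=
  ⟨hA, hodgeClasses_algebraic_of_hasDegree hX' hX g (Classical.choice h'.1) μ ν hd hg h'.2⟩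

/-- **Cor. 1.5 after a finite base change.** Arapura's corollary for `f : X ⟶ Y` follows as soon
as, for every such `f`, SOME smooth projective fourfold `X'` with a Hodge model, mapping to `X`
with non-zero degree, has its rational `(p,p)`-classes algebraic — the form in which the printed
proof uses its finite base change `Ỹ → Y` (the relative divisors `𝒵_i` trivialise `R²f_*ℚ` over a
finite cover of `U` only; `X'` a desingularised `X ×_Y Ỹ`, to which Thm. 1.2 is applied).
[cite: Arapura2022, proof of Cor. 1.5 (p. 5)] -/
theorem Arapura2022_hodgeConjecture_pgZeroSurfaceFibration_of_cover
    (hcov : ∀ ⦃X Y : Motives.SchemeOver ℂ⦄ (f : X ⟶ Y),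
      Motives.IsSmoothProjective 4 X → Motives.IsSmoothProjective 2 Y →
      Function.Surjective f.left.base →
      (∀ y : Y.left, IsPreconnected (f.left.base ⁻¹' {y})) →
      (∃ T : Set Y.left, IsClosed T ∧ T ≠ Set.univ ∧
        ∀ s : Motives.AlgPoints Y ℂ, s.pt ∉ T →
          Motives.IsSmoothProjective 2 (Motives.fiberOver f s) ∧
          ∃ A : HodgeModel 2 (Motives.fiberOver f s), Module.finrank ℂ ↥(A.hodgePQ 2 2 0) = 0) →
      ∃ (X' : Motives.SchemeOver ℂ) (g : X' ⟶ X) (_ : Motives.IsSmoothProjective 4 X')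
        (_ : HodgeModel 4 X') (μ : HomologicalOrientation ℂ (Motives.ComplexPoints X') (2 * 4))
        (ν : HomologicalOrientation ℂ (Motives.ComplexPoints X) (2 * 4)) (d : ℤ),
        d ≠ 0 ∧ HasDegree μ ν (Motives.AlgPoints.mapContinuous (L := ℂ) g) d ∧
        ∀ (p : ℕ) (c' : complexBetti X' (2 * p)), IsRationalClass c' →
          IsOfHodgeType 4 X' (2 * p) p p c' → c' ∈ algebraicClasses X' p) :
    Arapura2022_hodgeConjecture_pgZeroSurfaceFibration := by
  intro X Y f hX hY hf hconn hgen p c hc hpp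
  obtain ⟨X', g, hX', B, μ, ν, d, hd, hg, h'⟩ := hcov f hX hY hf hconn hgen
  exact hodgeClasses_algebraic_of_hasDegree hX' hX g B μ ν hd hg h' p c hc hpp

/-- **The whole printed skeleton of Cor. 1.5 on the tree's carriers: localisation on a finite base
change, then descent.** Granted the named facts of layers 1–2 (`hL`, `hHL`, `h3`, `hA`, `hD`, `hV`,
`hH`, as in `Arapura2022_hodgeConjecture_pgZeroSurfaceFibration_of_localization'`), Arapura's
corollary follows from the output of Thm. 1.2 taken — as in the printed proof — on the smooth part
of a FINITE BASE CHANGE: for every fibration `f : X ⟶ Y` as in Cor. 1.5 there are a smooth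
projective fourfold `X'`, a morphism `g : X' ⟶ X` of non-zero degree (`X'` a desingularised
`X ×_Y Ỹ`), and a proper Zariski-closed `Z' ⊊ X'` (the preimage of `Ỹ ∖ Ũ`) such that every
rational `(2,2)`-class of `X'` agrees off `Z'` with an algebraic class (`hVcov`). Proof: on `X'`,
localisation (`mem_algebraicClasses_of_localization'`, Lemma 1.2 + Thm. 1.1) gives the rational
`(2,2)`-classes, Lefschetz `(1,1)` and hard Lefschetz the other codimensions
(`hodgeClasses_algebraic_fourfold_of_hodgeTwoTwo`); then the conjecture descends to `X` along `g`
(`hodgeClasses_algebraic_of_hasDegree`), the Hodge model of `X'` coming from `hA`.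
[cite: Arapura2022, proof of Cor. 1.5 (p. 5), Cor. 1.4, Lemma 1.2 and Thm. 1.1] -/
theorem Arapura2022_hodgeConjecture_pgZeroSurfaceFibration_of_localization_cover
    (hL : lefschetzOneOne_rational)
    (hHL : ∀ X : Motives.SchemeOver ℂ, nonempty_hardLefschetzNFold 4 X)
    (h3 : hodgeClasses_algebraic_of_dim_le_three)
    (hA : ∀ (m : ℕ) (Y : Motives.SchemeOver ℂ), nonempty_hodgeModel m Y)
    (hD : Deligne1974_ker_restrictCompl_eq_iSup_range_complexGysin)
    (hV : Voisin2025_hodgeClass_lift_complexGysin) (hH : Resolution.Hironaka1964_projective.{0})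
    (hVcov : ∀ ⦃X Y : Motives.SchemeOver ℂ⦄ (f : X ⟶ Y),
      Motives.IsSmoothProjective 4 X → Motives.IsSmoothProjective 2 Y →
      Function.Surjective f.left.base →
      (∀ y : Y.left, IsPreconnected (f.left.base ⁻¹' {y})) →
      (∃ T : Set Y.left, IsClosed T ∧ T ≠ Set.univ ∧
        ∀ s : Motives.AlgPoints Y ℂ, s.pt ∉ T →
          Motives.IsSmoothProjective 2 (Motives.fiberOver f s) ∧
          ∃ A : HodgeModel 2 (Motives.fiberOver f s), Module.finrank ℂ ↥(A.hodgePQ 2 2 0) = 0) →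
      ∃ (X' : Motives.SchemeOver ℂ) (g : X' ⟶ X) (_ : Motives.IsSmoothProjective 4 X')
        (μ : HomologicalOrientation ℂ (Motives.ComplexPoints X') (2 * 4))
        (ν : HomologicalOrientation ℂ (Motives.ComplexPoints X) (2 * 4)) (d : ℤ),
        d ≠ 0 ∧ HasDegree μ ν (Motives.AlgPoints.mapContinuous (L := ℂ) g) d ∧
        ∃ Z' : Set X'.left, IsClosed Z' ∧ Z' ≠ Set.univ ∧
          ∀ c' : complexBetti X' (2 * 2), IsRationalClass c' → IsOfHodgeType 4 X' (2 * 2) 2 2 c' →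
            ∃ b ∈ algebraicClasses X' 2, complexBetti.restrictCompl X' Z' (2 * 2) (c' - b) = 0) :
    Arapura2022_hodgeConjecture_pgZeroSurfaceFibration := by
  intro X Y f hX hY hf hconn hgen p c hc hpp
  obtain ⟨X', g, hX', μ, ν, d, hd, hg, Z', hZ', hZ'ne, hcore⟩ := hVcov f hX hY hf hconn hgen
  -- the Hodge conjecture (cycle part) for the cover `X'`: localisation in codimension `2` …
  have h2 : ∀ c' : complexBetti X' (2 * 2), IsRationalClass c' → IsOfHodgeType 4 X' (2 * 2) 2 2 c' →
      c' ∈ algebraicClasses X' 2 := by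
    intro c' hc' hpp'
    obtain ⟨b, hb, hcb⟩ := hcore c' hc' hpp'
    exact mem_algebraicClasses_of_localization' hD hV hH hX' (hodgeConjectureFor_of_lt_four h3 hA)
      hZ' hZ'ne hc' hpp' hb hcb
  -- … Lefschetz `(1,1)` and hard Lefschetz in the other codimensions; then descent along `g`
  exact hodgeClasses_algebraic_of_hasDegree hX' hX g (Classical.choice (hA 4 X' hX')) μ ν hd hg
    (hodgeClasses_algebraic_fourfold_of_hodgeTwoTwo hL (hHL X') hX' h2) p c hc hpp

end Degree

end HodgeTheory

end Literature.AlgebraicGeometry.HodgeTheory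

end
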